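/-
Copyright (c) 2026. All rights reserved.
Released under Apache 2.0 license as described in the file LICENSE.
Authors: abc-iut cell — seat abc-iut-w4-d104 (gen 4): row «COR28/29-ANALYTIC-VALUES», file 2 — [AbsTopIII]
Cor 2.9 GENUINE from the Cor 2.8 (b) charts: the chart package read off `ChartsCover` + (AV) + uniformisers.
-/
import Literature.AnabelianGeometry.AbsoluteAnabelian.ArchimedeanReconstructionCor29AdditiveInput
import Literature.AnabelianGeometry.AbsoluteAnabelian.ArchimedeanReconstructionCor29GlobaliseBridge
import Literature.AnabelianGeometry.AbsoluteAnabelian.ArchimedeanReconstructionCor28Sub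
import HarnessLib

/-!
# [AbsTopIII] Cor 2.9 for the genuine datum FROM THE Cor 2.8 (b) CHARTS: the chart package is read off
# `ChartsCover`, the analytic input is (AV), plus a uniformiser at each NF-point and `κ : ℂ ≅ k_v`

S. Mochizuki, *Topics in absolute anabelian geometry III* (bib key `MochizukiAbsTopIII2015`), Cor 2.9
pp.64–65 over Cor 2.8 (a)(b) pp.63–64.  PROOF-ONLY file (no definitions), file 2 of row
«COR28/29-ANALYTIC-VALUES» (L4-lead GO 2026-08-26T12:00:33Z); sequel of `…Cor29GermEngaged.lean` (p442131),
`…Cor29AdditiveInput.lean` (p442782) and `…Cor28AnalyticValues.lean` (file 1).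

Up to now the Cor 2.9 instances for the genuine `D : NFCurveData` (p436603, p438727, p440549, p442131,
p442782) took an ABSTRACT chart package `(W_x, e_x, e'_x, r_x, G, κ)` at the NF-points as hypothesis (residual
(G) of L4-lead RULING #8d/#8g).  Here the package is READ OFF THE Cor 2.8 (b) CHARTS `f_U : U_X ⥲ U_v ⊆ k_v`
(abc-iut-w5-d140's typed row Cor-28.b.r11 `NFCurveData.ChartsCover`, p414194) through `κ : ℂ ≅ k_v`
(abc-iut-w4-d104's `exists_chartPackage_of_chart`, p436968), and the analytic half of (G) is the SAME binder
(AV) as in file 1 — so that Cor 2.8's chart independence and Cor 2.9 rest on ONE named analytic input: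

**(AV)** on every chart `f_U` and for every NF-rational `f` regular at `u₀ ∈ U_X`, the genuine extended values
`u ↦ lim_j f(u_j)` are near `u₀` a `k_v`-analytic function `F` of `f_U(u)`.

The remaining binders: `κ : ℂ ≃+* k_v` bicontinuous (print p.63: `k_v` = completion at an archimedean prime,
`≅ ℂ`); **(UNIF)** at every genuine NF-point `x` some NF-rational `f` vanishing at `x` (values `f(x_j) → 0`)
has a SIMPLE zero: every analytic chart expression of its values has non-zero derivative at `f_U(x)` (the
local ring at a point of the smooth curve `X_v` is a DVR and the NF-rational functions are all of `k̄(X)`,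
Thm 1.9 (d)); for the input local additive structures, their linearity in the chart `κ⁻¹ ∘ f_U` (Cor 2.7 (c):
abc-iut-w6-d024's `Cor27c.localAdd_planar_of_isPuncturedEllipticCurve`, p443220, proves exactly this
planarity for the genuine group law of every typed once-punctured elliptic curve).

GENUINE TERMS (no definitions): `isNFPoint x` := p438727's predicate (class of a Cauchy sequence of NF-points
converging to an NF-point); `fval f x := lim_j f(x_j)` (p438727); **`vanishesAt f x` := the values `f(x_j)`
CONVERGE TO `0`** (regular at `x` with value `0` — sharper than p438727's `fval f x = 0`, which it implies).

* `NFCurveData.globalArchimedeanCompatibility'_genuine_of_charts` — given charts at the genuine NF-points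
  (`UX x`, `c x`), `κ`, (AV), (UNIF): THERE IS a chart package subordinate to those charts
  (`κ (e_x v) = f_U(v)` on `W_x`) for which abc-iut-L4-t4's successor statement of record
  `GlobalArchimedeanCompatibility'` holds GENUINELY — germ structure `𝒜_x = germAut (e_x x)` with the germ
  action, `df|_x := κ((G x f)′(e_x x))` with `G x f = κ⁻¹ ∘ F ∘ κ` an (AV)-expression — both with the
  chart-transported `+ₓ` AND for every INPUT `+ₓ`, `(1/n)·ₓ` linear in the package charts;
* `NFCurveData.globalArchimedeanCompatibility'_genuine_of_chartsCover` — the same from w5-d140's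
  `D.ChartsCover` (charts at every point).

HONEST SCOPE: (AV), (UNIF), `κ`, and `ChartsCover` are NAMED inputs (the analytic structure of `X_v(k_v)`,
Cor-28 rows r8/r11, owed by Thm 1.9's `ArisesFrom`); existence of the genuine NF-points as classes
(`AnalyticComparison.PointsAreLimits`) is not assumed (vacuity where absent, honestly); functoriality
record-only.  Refereed pre-IUT material; nothing here bears on the disputed [IUTchIII] Cor. 3.12; typed ≠ endorsed.
-/

noncomputable section

namespace Literature.AnabelianGeometry.AbsoluteAnabelian

namespace ArchimedeanReconstruction

open _root_.Filter _root_.Topology _root_.Set _root_.TopologicalSpace _root_.Metric _root_.Function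
open Cor29 Cor29ChartPackage

variable {D : NFCurveData}

open Classical in
/-- **[AbsTopIII] Cor 2.9, GENUINE, from charts at the NF-points + (AV) + (UNIF) + `κ`.**  Given Cor 2.8 (b)
charts `c x : U_X(x) ⥲ U_v` at the genuine NF-points, an identification of topological fields `κ : ℂ ⥲ k_v`,
the analytic-values binder (AV) and simple-zero uniformisers (UNIF), THERE IS a chart package
`(W_x, e_x, e'_x, r_x)` SUBORDINATE to the charts (`κ (e_x v) = f_U(v)` on `W_x`) and chart expressions
`G x f` such that abc-iut-L4-t4's successor statement of record holds for the genuine datum, genuine NF-point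
predicate, genuine values, vanishing := "values converge to `0`", the germ structure `𝒜_x = germAut (e_x x)`
with the germ action — (1) with the chart-transported local additive structures, and (2) for EVERY input
`+ₓ`, `(1/n)·ₓ` linear in the package charts (Cor 2.7 (c)).
[cite: MochizukiAbsTopIII2015, Corollary 2.9 pp.64–65] -/
theorem NFCurveData.globalArchimedeanCompatibility'_genuine_of_charts (D : NFCurveData)
    (UX : D.Xtop → Opens D.Xtop) (c : ∀ x, D.Chart (UX x))
    (hxU : ∀ x : D.Xtop,
      (∃ (P : D.Pt) (s : {x : ℕ → D.Pt // D.IsCauchy x}), Quot.mk _ s = x ∧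
        ∀ f : D.Fn, D.eval f P ≠ none → Tendsto (fun j => D.valv f (s.1 j)) atTop (𝓝 (D.valv f P))) →
      x ∈ UX x)
    (κ : ℂ ≃+* D.kv) (hκ : Continuous κ) (hκ' : Continuous κ.symm)
    (hAV : ∀ (U : Opens D.Xtop) (ch : D.Chart U) (f : D.Fn) (x : D.Xtop) (hx : x ∈ U),
      (∃ a : D.kv, Tendsto (fun j => D.valv f ((Quot.out x).1 j)) atTop (𝓝 a)) →
      ∃ F : D.kv → D.kv, AnalyticAt D.kv F ((ch.fU ⟨x, hx⟩ : ch.Uv) : D.kv) ∧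
        ∀ᶠ u in 𝓝 x, ∀ hu : u ∈ U,
          limUnder atTop (fun j => D.valv f ((Quot.out u).1 j)) = F ((ch.fU ⟨u, hu⟩ : ch.Uv) : D.kv))
    (hunif : ∀ x : D.Xtop,
      (∃ (P : D.Pt) (s : {x : ℕ → D.Pt // D.IsCauchy x}), Quot.mk _ s = x ∧
        ∀ f : D.Fn, D.eval f P ≠ none → Tendsto (fun j => D.valv f (s.1 j)) atTop (𝓝 (D.valv f P))) →
      ∃ f : D.Fn, Tendsto (fun j => D.valv f ((Quot.out x).1 j)) atTop (𝓝 0) ∧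
        ∀ (U : Opens D.Xtop) (ch : D.Chart U) (hx : x ∈ U) (F : D.kv → D.kv),
          AnalyticAt D.kv F ((ch.fU ⟨x, hx⟩ : ch.Uv) : D.kv) →
          (∀ᶠ u in 𝓝 x, ∀ hu : u ∈ U,
            limUnder atTop (fun j => D.valv f ((Quot.out u).1 j)) = F ((ch.fU ⟨u, hu⟩ : ch.Uv) : D.kv)) →
          deriv F ((ch.fU ⟨x, hx⟩ : ch.Uv) : D.kv) ≠ 0) :
    ∃ (W : D.Xtop → Set D.Xtop) (e : D.Xtop → D.Xtop → ℂ) (e' : D.Xtop → ℂ → D.Xtop) (r : D.Xtop → ℝ)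
      (G : D.Xtop → D.Fn → ℂ → ℂ),
      (∀ x : D.Xtop,
        (∃ (P : D.Pt) (s : {x : ℕ → D.Pt // D.IsCauchy x}), Quot.mk _ s = x ∧
          ∀ f : D.Fn, D.eval f P ≠ none → Tendsto (fun j => D.valv f (s.1 j)) atTop (𝓝 (D.valv f P))) →
        x ∈ W x ∧ IsOpen (W x) ∧ ∀ v (hv : v ∈ UX x), v ∈ W x → κ (e x v) = ((c x).fU ⟨v, hv⟩ : D.kv)) ∧
      GlobalArchimedeanCompatibility' D (Cor29Model.planeStructure.comap (fun x : D.Xtop => e x x))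
        (fun x => ∃ (P : D.Pt) (s : {x : ℕ → D.Pt // D.IsCauchy x}), Quot.mk _ s = x ∧
          ∀ f : D.Fn, D.eval f P ≠ none → Tendsto (fun j => D.valv f (s.1 j)) atTop (𝓝 (D.valv f P)))
        (fun _ => D.kv) (fun x f => κ (deriv (G x f) (e x x)))
        (fun f x => Tendsto (fun j => D.valv f ((Quot.out x).1 j)) atTop (𝓝 0))
        (fun x a b => e' x (e x a + e x b - e x x))
        (fun x n v => if v ∈ W x ∧ ‖e x v - e x x‖ < r x / 2 then e' x (e x x + (e x v - e x x) / (n : ℂ))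
          else x)
        (fun f x => limUnder atTop (fun j => D.valv f ((Quot.out x).1 j)))
        (fun x u v => e' x (Cor29Model.act (e x x) u (e x v))) ∧
      ∀ (ladd₀ : D.Xtop → D.Xtop → D.Xtop → D.Xtop) (scale₀ : D.Xtop → ℕ → D.Xtop → D.Xtop),
        (∀ x : D.Xtop,
          (∃ (P : D.Pt) (s : {x : ℕ → D.Pt // D.IsCauchy x}), Quot.mk _ s = x ∧
            ∀ f : D.Fn, D.eval f P ≠ none → Tendsto (fun j => D.valv f (s.1 j)) atTop (𝓝 (D.valv f P))) →
          (∀ a ∈ W x, ∀ b ∈ W x, ladd₀ x a b = e' x (e x a + e x b - e x x)) ∧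
            ∀ n : ℕ, 0 < n → ∀ v ∈ W x, scale₀ x n v = e' x (e x x + (e x v - e x x) / (n : ℂ))) →
        GlobalArchimedeanCompatibility' D (Cor29Model.planeStructure.comap (fun x : D.Xtop => e x x))
          (fun x => ∃ (P : D.Pt) (s : {x : ℕ → D.Pt // D.IsCauchy x}), Quot.mk _ s = x ∧
            ∀ f : D.Fn, D.eval f P ≠ none → Tendsto (fun j => D.valv f (s.1 j)) atTop (𝓝 (D.valv f P)))
          (fun _ => D.kv) (fun x f => κ (deriv (G x f) (e x x)))
          (fun f x => Tendsto (fun j => D.valv f ((Quot.out x).1 j)) atTop (𝓝 0))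
          ladd₀ (fun x n v => if v ∈ W x ∧ ‖e x v - e x x‖ < r x / 2 then scale₀ x n v else x)
          (fun f x => limUnder atTop (fun j => D.valv f ((Quot.out x).1 j)))
          (fun x u v => e' x (Cor29Model.act (e x x) u (e x v))) := by
  -- abbreviation for the genuine NF-point predicate
  set NF : D.Xtop → Prop := fun x => ∃ (P : D.Pt) (s : {x : ℕ → D.Pt // D.IsCauchy x}), Quot.mk _ s = x ∧
    ∀ f : D.Fn, D.eval f P ≠ none → Tendsto (fun j => D.valv f (s.1 j)) atTop (𝓝 (D.valv f P)) with hNF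
  -- Step 1: the chart package at every genuine NF-point, read off the Cor 2.8 (b) chart through `κ`
  have hP : ∀ x : D.Xtop, ∃ (W : Set D.Xtop) (e : D.Xtop → ℂ) (e' : ℂ → D.Xtop) (r : ℝ), NF x →
      0 < r ∧ IsOpen W ∧ x ∈ W ∧ ContinuousOn e W ∧ MapsTo e W (ball (e x) r) ∧
        ContinuousOn e' (ball (e x) r) ∧ MapsTo e' (ball (e x) r) W ∧ (∀ v ∈ W, e' (e v) = v) ∧
        (∀ w ∈ ball (e x) r, e (e' w) = w) ∧
        ∀ v (hv : v ∈ UX x), v ∈ W → κ (e v) = ((c x).fU ⟨v, hv⟩ : D.kv) := by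
    intro x
    by_cases hx : NF x
    · obtain ⟨W, e, e', r, h⟩ := D.exists_chartPackage_of_chart (c x) κ hκ hκ' (hxU x hx)
      exact ⟨W, e, e', r, fun _ => h⟩
    · exact ⟨∅, fun _ => 0, fun _ => x, 1, fun h => absurd h hx⟩
  choose W e e' r hpkg using hP
  -- Step 2: chart expressions `G x f := κ⁻¹ ∘ F ∘ κ` from (AV), at NF-points and vanishing `f`
  have hFex : ∀ (x : D.Xtop) (f : D.Fn), ∃ F : D.kv → D.kv, ∀ hx : NF x,
      Tendsto (fun j => D.valv f ((Quot.out x).1 j)) atTop (𝓝 0) →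
        AnalyticAt D.kv F (((c x).fU ⟨x, hxU x hx⟩ : (c x).Uv) : D.kv) ∧
          ∀ᶠ u in 𝓝 x, ∀ hu : u ∈ UX x,
            limUnder atTop (fun j => D.valv f ((Quot.out u).1 j)) = F (((c x).fU ⟨u, hu⟩ : (c x).Uv) : D.kv) := by
    intro x f
    by_cases hx : NF x
    · by_cases hv : Tendsto (fun j => D.valv f ((Quot.out x).1 j)) atTop (𝓝 0)
      · obtain ⟨F, hFa, hFe⟩ := hAV (UX x) (c x) f x (hxU x hx) ⟨0, hv⟩
        exact ⟨F, fun _ _ => ⟨hFa, hFe⟩⟩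
      · exact ⟨fun _ => 0, fun _ h => absurd h hv⟩
    · exact ⟨fun _ => 0, fun h => absurd h hx⟩
  choose F hF using hFex
  -- the point identity `κ (e_x x) = f_U(x)` and the two package hypotheses of p436603's shape
  have hpt : ∀ x (hx : NF x), κ (e x x) = (((c x).fU ⟨x, hxU x hx⟩ : (c x).Uv) : D.kv) := fun x hx =>
    (hpkg x hx).2.2.2.2.2.2.2.2.2 x (hxU x hx) (hpkg x hx).2.2.1
  have hGpkg : ∀ x, NF x → ∀ f : D.Fn, Tendsto (fun j => D.valv f ((Quot.out x).1 j)) atTop (𝓝 0) →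
      DifferentiableAt ℂ (fun z => κ.symm (F x f (κ z))) (e x x) ∧
        (∀ᶠ u in 𝓝 x, κ.symm (limUnder atTop (fun j => D.valv f ((Quot.out u).1 j))) =
          (fun z => κ.symm (F x f (κ z))) (e x u)) ∧
        limUnder atTop (fun j => D.valv f ((Quot.out x).1 j)) = 0 := by
    intro x hx f hf
    obtain ⟨hFa, hFe⟩ := hF x f hx hf
    have hFd : DifferentiableAt D.kv (F x f) (κ (e x x)) := by
      rw [hpt x hx]; exact hFa.differentiableAt
    refine ⟨(differentiableAt_ringEquiv_conj κ hκ hκ' hFd).1, ?_, hf.limUnder_eq⟩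
    filter_upwards [hFe, (hpkg x hx).2.1.mem_nhds (hpkg x hx).2.2.1, (UX x).isOpen.mem_nhds (hxU x hx)]
      with u hu huW huU
    show κ.symm _ = κ.symm (F x f (κ (e x u)))
    rw [hu huU, (hpkg x hx).2.2.2.2.2.2.2.2.2 u huU huW]
  have hspan : ∀ x, NF x → ∃ f : D.Fn, Tendsto (fun j => D.valv f ((Quot.out x).1 j)) atTop (𝓝 0) ∧
      deriv (fun z => κ.symm (F x f (κ z))) (e x x) ≠ 0 := by
    intro x hx
    obtain ⟨f, hf0, hsimple⟩ := hunif x hx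
    obtain ⟨hFa, hFe⟩ := hF x f hx hf0
    have hd : deriv (F x f) (((c x).fU ⟨x, hxU x hx⟩ : (c x).Uv) : D.kv) ≠ 0 :=
      hsimple (UX x) (c x) (hxU x hx) (F x f) hFa hFe
    have hFd : DifferentiableAt D.kv (F x f) (κ (e x x)) := by
      rw [hpt x hx]; exact hFa.differentiableAt
    refine ⟨f, hf0, ?_⟩
    rw [(differentiableAt_ringEquiv_conj κ hκ hκ' hFd).2, map_ne_zero_iff _ κ.symm.injective, hpt x hx]
    exact hd
  refine ⟨W, e, e', r, fun x f z => κ.symm (F x f (κ z)), fun x hx =>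
    ⟨(hpkg x hx).2.2.1, (hpkg x hx).2.1, (hpkg x hx).2.2.2.2.2.2.2.2.2⟩, ?_, fun ladd₀ scale₀ hlin => ?_⟩
  · exact D.globalArchimedeanCompatibility'_of_chartPackage_of
      (Cor29Model.planeStructure.comap (fun x : D.Xtop => e x x)) NF W e e' r
      (fun x hx => (hpkg x hx).1) (fun x hx => ⟨(hpkg x hx).2.1, (hpkg x hx).2.2.1⟩)
      (fun x hx => ⟨(hpkg x hx).2.2.2.1, (hpkg x hx).2.2.2.2.1⟩)
      (fun x hx => ⟨(hpkg x hx).2.2.2.2.2.1, (hpkg x hx).2.2.2.2.2.2.1⟩)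
      (fun x hx => (hpkg x hx).2.2.2.2.2.2.2.1) (fun x hx => (hpkg x hx).2.2.2.2.2.2.2.2.1)
      (fun f x => limUnder atTop (fun j => D.valv f ((Quot.out x).1 j)))
      (fun f x => Tendsto (fun j => D.valv f ((Quot.out x).1 j)) atTop (𝓝 0))
      (fun x f z => κ.symm (F x f (κ z))) κ hκ hκ' hGpkg (fun f x h => h.limUnder_eq) hspan
  · exact D.globalArchimedeanCompatibility'_of_chartPackage_input
      (Cor29Model.planeStructure.comap (fun x : D.Xtop => e x x)) NF W e e' r
      (fun x hx => (hpkg x hx).1) (fun x hx => ⟨(hpkg x hx).2.1, (hpkg x hx).2.2.1⟩)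
      (fun x hx => ⟨(hpkg x hx).2.2.2.1, (hpkg x hx).2.2.2.2.1⟩)
      (fun x hx => ⟨(hpkg x hx).2.2.2.2.2.1, (hpkg x hx).2.2.2.2.2.2.1⟩)
      (fun x hx => (hpkg x hx).2.2.2.2.2.2.2.1) (fun x hx => (hpkg x hx).2.2.2.2.2.2.2.2.1)
      ladd₀ scale₀ (fun x hx => (hlin x hx).1) (fun x hx => (hlin x hx).2)
      (fun f x => limUnder atTop (fun j => D.valv f ((Quot.out x).1 j)))
      (fun f x => Tendsto (fun j => D.valv f ((Quot.out x).1 j)) atTop (𝓝 0))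
      (fun x f z => κ.symm (F x f (κ z))) κ hκ hκ' hGpkg (fun f x h => h.limUnder_eq) hspan

open Classical in
/-- **[AbsTopIII] Cor 2.9, GENUINE, from w5-d140's `ChartsCover` + (AV) + (UNIF) + `κ`**: if every point of
`X^top` carries a Cor 2.8 (b) chart (row Cor-28.b.r11 `NFCurveData.ChartsCover`, p414194), then — choosing a
chart at each point — the conclusion of `globalArchimedeanCompatibility'_genuine_of_charts` holds: a chart
package subordinate to Cor 2.8 (b) charts exists for which the successor statement of record holds genuinely
(germ `L`, genuine NF-points / values, transported or input additive structures).  So Cor 2.9's residual (G)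
and Cor 2.8's chart independence rest on the same named inputs: `ChartsCover`, (AV), (UNIF), `κ`.
[cite: MochizukiAbsTopIII2015, Corollary 2.9 pp.64–65] -/
theorem NFCurveData.globalArchimedeanCompatibility'_genuine_of_chartsCover (D : NFCurveData)
    (hC : D.ChartsCover) (κ : ℂ ≃+* D.kv) (hκ : Continuous κ) (hκ' : Continuous κ.symm)
    (hAV : ∀ (U : Opens D.Xtop) (ch : D.Chart U) (f : D.Fn) (x : D.Xtop) (hx : x ∈ U),
      (∃ a : D.kv, Tendsto (fun j => D.valv f ((Quot.out x).1 j)) atTop (𝓝 a)) →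
      ∃ F : D.kv → D.kv, AnalyticAt D.kv F ((ch.fU ⟨x, hx⟩ : ch.Uv) : D.kv) ∧
        ∀ᶠ u in 𝓝 x, ∀ hu : u ∈ U,
          limUnder atTop (fun j => D.valv f ((Quot.out u).1 j)) = F ((ch.fU ⟨u, hu⟩ : ch.Uv) : D.kv))
    (hunif : ∀ x : D.Xtop,
      (∃ (P : D.Pt) (s : {x : ℕ → D.Pt // D.IsCauchy x}), Quot.mk _ s = x ∧
        ∀ f : D.Fn, D.eval f P ≠ none → Tendsto (fun j => D.valv f (s.1 j)) atTop (𝓝 (D.valv f P))) →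
      ∃ f : D.Fn, Tendsto (fun j => D.valv f ((Quot.out x).1 j)) atTop (𝓝 0) ∧
        ∀ (U : Opens D.Xtop) (ch : D.Chart U) (hx : x ∈ U) (F : D.kv → D.kv),
          AnalyticAt D.kv F ((ch.fU ⟨x, hx⟩ : ch.Uv) : D.kv) →
          (∀ᶠ u in 𝓝 x, ∀ hu : u ∈ U,
            limUnder atTop (fun j => D.valv f ((Quot.out u).1 j)) = F ((ch.fU ⟨u, hu⟩ : ch.Uv) : D.kv)) →
          deriv F ((ch.fU ⟨x, hx⟩ : ch.Uv) : D.kv) ≠ 0) :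
    ∃ (UX : D.Xtop → Opens D.Xtop) (c : ∀ x, D.Chart (UX x)) (W : D.Xtop → Set D.Xtop)
      (e : D.Xtop → D.Xtop → ℂ) (e' : D.Xtop → ℂ → D.Xtop) (r : D.Xtop → ℝ) (G : D.Xtop → D.Fn → ℂ → ℂ),
      (∀ x : D.Xtop, x ∈ UX x) ∧
      (∀ x : D.Xtop,
        (∃ (P : D.Pt) (s : {x : ℕ → D.Pt // D.IsCauchy x}), Quot.mk _ s = x ∧
          ∀ f : D.Fn, D.eval f P ≠ none → Tendsto (fun j => D.valv f (s.1 j)) atTop (𝓝 (D.valv f P))) →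
        x ∈ W x ∧ IsOpen (W x) ∧ ∀ v (hv : v ∈ UX x), v ∈ W x → κ (e x v) = ((c x).fU ⟨v, hv⟩ : D.kv)) ∧
      GlobalArchimedeanCompatibility' D (Cor29Model.planeStructure.comap (fun x : D.Xtop => e x x))
        (fun x => ∃ (P : D.Pt) (s : {x : ℕ → D.Pt // D.IsCauchy x}), Quot.mk _ s = x ∧
          ∀ f : D.Fn, D.eval f P ≠ none → Tendsto (fun j => D.valv f (s.1 j)) atTop (𝓝 (D.valv f P)))
        (fun _ => D.kv) (fun x f => κ (deriv (G x f) (e x x)))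
        (fun f x => Tendsto (fun j => D.valv f ((Quot.out x).1 j)) atTop (𝓝 0))
        (fun x a b => e' x (e x a + e x b - e x x))
        (fun x n v => if v ∈ W x ∧ ‖e x v - e x x‖ < r x / 2 then e' x (e x x + (e x v - e x x) / (n : ℂ))
          else x)
        (fun f x => limUnder atTop (fun j => D.valv f ((Quot.out x).1 j)))
        (fun x u v => e' x (Cor29Model.act (e x x) u (e x v))) ∧
      ∀ (ladd₀ : D.Xtop → D.Xtop → D.Xtop → D.Xtop) (scale₀ : D.Xtop → ℕ → D.Xtop → D.Xtop),
        (∀ x : D.Xtop,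
          (∃ (P : D.Pt) (s : {x : ℕ → D.Pt // D.IsCauchy x}), Quot.mk _ s = x ∧
            ∀ f : D.Fn, D.eval f P ≠ none → Tendsto (fun j => D.valv f (s.1 j)) atTop (𝓝 (D.valv f P))) →
          (∀ a ∈ W x, ∀ b ∈ W x, ladd₀ x a b = e' x (e x a + e x b - e x x)) ∧
            ∀ n : ℕ, 0 < n → ∀ v ∈ W x, scale₀ x n v = e' x (e x x + (e x v - e x x) / (n : ℂ))) →
        GlobalArchimedeanCompatibility' D (Cor29Model.planeStructure.comap (fun x : D.Xtop => e x x))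
          (fun x => ∃ (P : D.Pt) (s : {x : ℕ → D.Pt // D.IsCauchy x}), Quot.mk _ s = x ∧
            ∀ f : D.Fn, D.eval f P ≠ none → Tendsto (fun j => D.valv f (s.1 j)) atTop (𝓝 (D.valv f P)))
          (fun _ => D.kv) (fun x f => κ (deriv (G x f) (e x x)))
          (fun f x => Tendsto (fun j => D.valv f ((Quot.out x).1 j)) atTop (𝓝 0))
          ladd₀ (fun x n v => if v ∈ W x ∧ ‖e x v - e x x‖ < r x / 2 then scale₀ x n v else x)
          (fun f x => limUnder atTop (fun j => D.valv f ((Quot.out x).1 j)))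
          (fun x u v => e' x (Cor29Model.act (e x x) u (e x v))) := by
  choose UX hxU _hconn c _hcUv using hC
  obtain ⟨W, e, e', r, G, hsub, h1, h2⟩ := D.globalArchimedeanCompatibility'_genuine_of_charts UX c
    (fun x _ => hxU x) κ hκ hκ' hAV hunif
  exact ⟨UX, c, W, e, e', r, G, hxU, hsub, h1, h2⟩

end ArchimedeanReconstruction

end Literature.AnabelianGeometry.AbsoluteAnabelian

end
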